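import Mathlib.Data.ZMod.Basic
import Mathlib.Data.Fintype.BigOperators
import Literature.Computability.MetaComplexity.Resolution
import HarnessLib

/-!
# Tseitin formulas: satisfiable iff the total charge is even (Urquhart 1987, Lemma 4.1)

Sibling proof file of `Resolution.lean` (D-0014: named facts `def X : Prop` are discharged as
`theorem X_holds : X`). It discharges
`Literature.Computability.MetaComplexity.tseitinCNF_satisfiable_iff_holds` — for a connected
graph `G` on `Fin v`, the Tseitin CNF `tseitinCNF G χ` is satisfiable iff the number of
charged vertices `#{u | χ u = true}` is even. (The direction "odd charge ⟹ unsatisfiable",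
which needs no connectivity, is also the named fact `tseitinCNF_not_satisfiable`, discharged
independently in `ResolutionProofs.lean` via the degree-sum formula; here it is
`even_card_of_eval_tseitinCNF`, by a fixed-point-free involution, so that this file depends
on `Resolution.lean` only.)

Source. A. Urquhart, *Hard examples for resolution*, J. ACM 34 (1987) 209–219, §4, p. 213:
"LEMMA 4.1. If `G` is a connected graph, then the set of clauses `S(G')` is contradictory if
and only if `Charge(G') = 1`." Printed proof: (odd ⟹ contradictory) "if we sum the left-hand
side of all the mod 2 equations associated with the vertices of `G`, the result is `0`,
because each literal is attached to exactly two vertices and hence occurs twice in the sum.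
On the other hand, the right-hand side sums to `1`"; (even ⟹ satisfiable) complementing a
literal and the charges of the two vertices it links ("transferring a charge from `x` to
`y`") gives an equivalent system; transferring successively along a path between two
vertices of odd charge leaves "two fewer vertices with an odd charge. By repeating this
process, we finally obtain a set of equations in which the RHS is uniformly 0. A satisfying
assignment is obtained by making all literals take the value 0." The vendored `tseitinCNF`
labels every edge `e` by the positive literal `x_e` (Urquhart allows either sign), so the
named fact is Lemma 4.1 for this labelling, in the contrapositive form "satisfiable iff the
charge is even" (also Krajíček, *Proof Complexity*, CUP 2019, Lemma 13.1.1).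

## Proof architecture

For `σ : ℕ → Bool`, the finite set `{w | G.Adj u w ∧ σ (x_{s(u,w)}) = true}` of neighbours
along true edges is Urquhart's `Charge(σ, u)` (through its parity); edge labellings in the
construction take values in `ZMod 2`, where transferring a charge is adding an indicator.
(1) `forall_mem_tseitinVertexClauses_iff`, `eval_tseitinCNF_eq_true_iff`: `Clauses(u)` holds
under `σ` iff the number of true edges at `u` has the parity `χ u` (the clause indexed by `S`
is falsified exactly by the indicator assignment of `S`). (2) `sum_card_filter_adj_eq_zero`:
the left-hand sides sum to `0` — the counted ordered pairs `(u, w)` are swapped without fixed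
points (`Finset.sum_ninvolution`); hence `even_card_of_eval_tseitinCNF`. (3) transfers:
`sum_filter_adj_add_indicator` (one edge), `exists_edgeLabel_walk` (along a walk, induction),
`exists_edgeLabel_of_sum_eq_zero` (induction on the number of charged vertices). (4) the
injective edge numbering (`tseitinEdgeVar_injective`) turns a labelling into an assignment.
-/

namespace Literature.Computability.MetaComplexity

open Complexity

variable {v : ℕ}

/-! ### The neighbour lists and the edge numbering -/

/-- Membership in the neighbour list `tseitinNeighbors G u` is adjacency.
[Urquhart 1987, §4 (`Lit(x)`, the literals attached to `x`)] [cite: Urquhart1987, §4] -/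
theorem mem_tseitinNeighbors_iff (G : SimpleGraph (Fin v)) [DecidableRel G.Adj] {u w : Fin v} :
    w ∈ tseitinNeighbors G u ↔ G.Adj u w := by
  simp [tseitinNeighbors]

/-- The neighbour list `tseitinNeighbors G u` has no duplicates (one literal per edge at `u`).
[Urquhart 1987, §4] [cite: Urquhart1987, §4] -/
theorem nodup_tseitinNeighbors (G : SimpleGraph (Fin v)) [DecidableRel G.Adj] (u : Fin v) :
    (tseitinNeighbors G u).Nodup :=
  (List.nodup_finRange v).filter _

/-- The edge numbering `tseitinEdgeVar e = min e * v + max e` is injective (`max e` is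
`· % v`, `min e` is `· / v`): distinct edges get distinct variables ("associating a distinct
variable with each edge", Urquhart 1987, §4, p. 212). [cite: Urquhart1987, §4] -/
theorem tseitinEdgeVar_injective : Function.Injective (tseitinEdgeVar (v := v)) := by
  have key : ∀ e : Sym2 (Fin v), tseitinEdgeVar e % v = e.sup ∧ tseitinEdgeVar e / v = e.inf :=
    fun e => by
      rw [tseitinEdgeVar, Nat.mul_comm, Nat.mul_add_mod, Nat.mul_add_div (Fin.pos e.sup),
        Nat.mod_eq_of_lt e.sup.isLt, Nat.div_eq_of_lt e.sup.isLt, Nat.add_zero]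
      exact ⟨rfl, rfl⟩
  intro e e' h
  obtain ⟨h₁, h₂⟩ := key e
  rw [h] at h₁ h₂
  exact Sym2.inf_eq_inf_and_sup_eq_sup.1
    ⟨Fin.ext (h₂.symm.trans (key e').2), Fin.ext (h₁.symm.trans (key e').1)⟩

/-! ### Semantics of the vertex clauses: the parity constraint -/

/-- If at `u` the assignment `σ` (read on the edge variables `x_{s(u,w)}`) is the indicator of
a sub-list `S` of the neighbour list, then `|S|` is the number of neighbours `w` of `u` with
`x_{s(u,w)}` true. [Urquhart 1987, §4, p. 213] [cite: Urquhart1987, §4] -/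
theorem length_eq_card_filter_adj_of_forall_eq_decide (G : SimpleGraph (Fin v))
    [DecidableRel G.Adj] (σ : ℕ → Bool) (u : Fin v) {S : List (Fin v)}
    (hS : S.Sublist (tseitinNeighbors G u))
    (hσ : ∀ w ∈ tseitinNeighbors G u, σ (tseitinEdgeVar s(u, w)) = decide (w ∈ S)) :
    S.length =
      (Finset.univ.filter (fun w => G.Adj u w ∧ σ (tseitinEdgeVar s(u, w)) = true)).card := by
  rw [← List.toFinset_card_of_nodup (hS.nodup (nodup_tseitinNeighbors G u))]
  congr 1
  ext w
  simp only [List.mem_toFinset, Finset.mem_filter, Finset.mem_univ, true_and]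
  constructor
  · intro hw
    have hwL := hS.subset hw
    refine ⟨(mem_tseitinNeighbors_iff G).1 hwL, ?_⟩
    rw [hσ w hwL]
    exact decide_eq_true hw
  · rintro ⟨hadj, hw⟩
    have hwL := (mem_tseitinNeighbors_iff G).2 hadj
    rw [hσ w hwL] at hw
    exact of_decide_eq_true hw

/-- **The vertex clauses express the parity constraint** ("`Clauses(x)` is the conjunctive
normal form of the modulo 2 equation `q₁ ⊕ ⋯ ⊕ qₙ = Charge(x)`", Urquhart 1987, §4,
p. 213): all clauses of `tseitinVertexClauses G χ u` are true under `σ` iff the number of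
neighbours `w` of `u` with `x_{s(u,w)}` true has the parity `χ u`; the clause indexed by `S`
is falsified exactly when `σ` at `u` is the indicator of `S`. [cite: Urquhart1987, §4] -/
theorem forall_mem_tseitinVertexClauses_iff (G : SimpleGraph (Fin v)) [DecidableRel G.Adj]
    (χ : Fin v → Bool) (σ : ℕ → Bool) (u : Fin v) :
    (∀ c ∈ tseitinVertexClauses G χ u, Clause.eval σ c = true) ↔
      (Finset.univ.filter
        (fun w => G.Adj u w ∧ σ (tseitinEdgeVar s(u, w)) = true)).card % 2 = (χ u).toNat := by
  set L := tseitinNeighbors G u with hL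
  -- the clause indexed by `S` is falsified iff `σ` at `u` is the indicator of `S`
  have hfalse : ∀ S : List (Fin v),
      (L.map fun w => (tseitinEdgeVar s(u, w), decide (w ∉ S))).any (Literal.eval σ) = false ↔
        ∀ w ∈ L, σ (tseitinEdgeVar s(u, w)) = decide (w ∈ S) := by
    intro S
    simp only [List.any_eq_false, List.mem_map, forall_exists_index, and_imp,
      forall_apply_eq_imp_iff₂, Literal.eval]
    refine forall₂_congr fun w _ => ?_
    cases σ (tseitinEdgeVar s(u, w)) <;> by_cases h : w ∈ S <;> simp [h]
  constructor
  · intro h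
    by_contra hne
    -- the clause indexed by the list `S` of true neighbours is in `Clauses(u)` and is false
    set S := L.filter fun w => σ (tseitinEdgeVar s(u, w)) with hS
    have hind : ∀ w ∈ L, σ (tseitinEdgeVar s(u, w)) = decide (w ∈ S) := fun w hw => by
      by_cases hσ : σ (tseitinEdgeVar s(u, w)) = true <;> simp [hS, List.mem_filter, hw, hσ]
    have hlen :=
      length_eq_card_filter_adj_of_forall_eq_decide G σ u (S := S) List.filter_sublist hind
    have hmem : (L.map fun w => (tseitinEdgeVar s(u, w), decide (w ∉ S))) ∈
        tseitinVertexClauses G χ u :=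
      List.mem_map.2 ⟨S, List.mem_filter.2 ⟨List.mem_sublists.2 List.filter_sublist,
        by simpa [hlen] using hne⟩, rfl⟩
    have := h _ hmem
    unfold Clause.eval at this
    rw [(hfalse S).2 hind] at this
    exact Bool.false_ne_true this
  · intro h c hc
    obtain ⟨S, hS, rfl⟩ := List.mem_map.1 hc
    obtain ⟨hSsub, hSpar⟩ := List.mem_filter.1 hS
    rw [List.mem_sublists] at hSsub
    have hSpar' : S.length % 2 ≠ (χ u).toNat := by simpa using hSpar
    by_contra hcfalse
    have hall : ∀ w ∈ L, σ (tseitinEdgeVar s(u, w)) = decide (w ∈ S) :=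
      (hfalse S).1 (by simpa [Clause.eval] using hcfalse)
    rw [length_eq_card_filter_adj_of_forall_eq_decide G σ u hSsub hall] at hSpar'
    exact hSpar' h

/-- **Semantics of the Tseitin CNF**: `τ(G, χ)` is true under `σ` iff at every vertex `u` the
number of incident edges set to true has the parity `χ u` (the system of mod 2 equations
`E(x)`, `x ∈ G`, of Urquhart 1987, §4, p. 213). [cite: Urquhart1987, §4] -/
theorem eval_tseitinCNF_eq_true_iff (G : SimpleGraph (Fin v)) [DecidableRel G.Adj]
    (χ : Fin v → Bool) (σ : ℕ → Bool) :
    (tseitinCNF G χ).eval σ = true ↔ ∀ u : Fin v,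
      (Finset.univ.filter
        (fun w => G.Adj u w ∧ σ (tseitinEdgeVar s(u, w)) = true)).card % 2 = (χ u).toNat := by
  rw [CNF.eval_eq_true_iff]
  constructor
  · intro h u
    refine (forall_mem_tseitinVertexClauses_iff G χ σ u).1 fun c hc => h c ?_
    unfold tseitinCNF
    exact List.mem_flatMap.2 ⟨u, List.mem_finRange u, hc⟩
  · intro h c hc
    unfold tseitinCNF at hc
    obtain ⟨u, -, hu⟩ := List.mem_flatMap.1 hc
    exact (forall_mem_tseitinVertexClauses_iff G χ σ u).2 (h u) c hu

/-! ### Summing the left-hand sides: every edge is counted twice -/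

/-- **Each literal is attached to exactly two vertices** (Urquhart 1987, proof of Lemma 4.1,
p. 213): summed over all `u`, the numbers of neighbours `w` with `x_{s(u,w)}` true add up to
`0` mod `2` — the counted pairs `(u, w)` are swapped without fixed points; no connectivity
is needed. [cite: Urquhart1987, Lemma 4.1] -/
theorem sum_card_filter_adj_eq_zero (G : SimpleGraph (Fin v)) [DecidableRel G.Adj]
    (σ : ℕ → Bool) :
    (∑ u : Fin v, ((Finset.univ.filter
      (fun w => G.Adj u w ∧ σ (tseitinEdgeVar s(u, w)) = true)).card : ZMod 2)) = 0 := by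
  simp only [Finset.natCast_card_filter]
  rw [← Fintype.sum_prod_type']
  refine Finset.sum_ninvolution Prod.swap ?_ ?_ (fun _ => Finset.mem_univ _) Prod.swap_swap
  · rintro ⟨u, w⟩
    simp only [Prod.fst_swap, Prod.snd_swap]
    by_cases huw : G.Adj u w ∧ σ (tseitinEdgeVar s(u, w)) = true
    · rw [if_pos huw, if_pos ⟨huw.1.symm, by rw [Sym2.eq_swap]; exact huw.2⟩]
      decide
    · rw [if_neg huw, if_neg fun h' => huw ⟨h'.1.symm, by rw [Sym2.eq_swap]; exact h'.2⟩,
        add_zero]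
  · rintro ⟨u, w⟩ hne heq
    simp only [Prod.swap_prod_mk, Prod.mk.injEq] at heq
    obtain ⟨rfl, -⟩ := heq
    exact hne (if_neg fun h' => G.irrefl h'.1)

/-! ### Transferring charges along walks -/

/-- **Transferring a charge across one edge** (Urquhart 1987, proof of Lemma 4.1, p. 213:
complementing the literal of an edge complements the charge "of the vertices `x` and `y`
which it links"): adding the indicator of the edge `s(a, b)` of `G` to an edge labelling `x`
changes the induced charge `∑_{w ∼ u} x(s(u, w))` exactly at `a` and at `b`.
[cite: Urquhart1987, Lemma 4.1] -/
theorem sum_filter_adj_add_indicator (G : SimpleGraph (Fin v)) [DecidableRel G.Adj]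
    (x : Sym2 (Fin v) → ZMod 2) {a b : Fin v} (hab : G.Adj a b) (u : Fin v) :
    (∑ w ∈ Finset.univ.filter (G.Adj u ·),
        (x s(u, w) + if s(u, w) = s(a, b) then 1 else 0)) =
      (∑ w ∈ Finset.univ.filter (G.Adj u ·), x s(u, w)) +
        (if u = a then 1 else 0) + (if u = b then 1 else 0) := by
  rw [Finset.sum_add_distrib, add_assoc]
  congr 1
  have hne : a ≠ b := G.ne_of_adj hab
  rcases eq_or_ne u a with rfl | hua
  · -- at `a`: exactly the neighbour `b` contributes
    simp only [Sym2.congr_right]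
    rw [Finset.sum_ite_eq']
    simp [hab, hne]
  · rcases eq_or_ne u b with rfl | hub
    · -- at `b`: exactly the neighbour `a` contributes
      have hiff : ∀ w, (s(u, w) = s(a, u) ↔ w = a) := fun w => by
        rw [Sym2.eq_iff]
        simp [hua]
      simp only [hiff]
      rw [Finset.sum_ite_eq']
      simp [hab.symm, hua]
    · -- elsewhere nothing changes
      simp [hua, hub]

/-- **Transferring a charge along a path** (Urquhart 1987, proof of Lemma 4.1, p. 213: "if we
successively transfer a charge from `v₁` to `v₂` to … `vₙ`", the odd charges at the two ends
disappear): for every walk from `a` to `b` and every edge labelling `x` some labelling has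
induced charges differing from those of `x` exactly by the indicators of `a` and of `b`
(induction on the walk, one edge at a time). [cite: Urquhart1987, Lemma 4.1] -/
theorem exists_edgeLabel_walk (G : SimpleGraph (Fin v)) [DecidableRel G.Adj] {a b : Fin v}
    (p : G.Walk a b) (x : Sym2 (Fin v) → ZMod 2) :
    ∃ x' : Sym2 (Fin v) → ZMod 2, ∀ u : Fin v,
      (∑ w ∈ Finset.univ.filter (G.Adj u ·), x' s(u, w)) =
        (∑ w ∈ Finset.univ.filter (G.Adj u ·), x s(u, w)) +
          (if u = a then 1 else 0) + (if u = b then 1 else 0) := by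
  induction p generalizing x with
  | nil =>
    refine ⟨x, fun u => ?_⟩
    have h2 : ∀ S A : ZMod 2, S = S + A + A := by decide
    exact h2 _ _
  | @cons a c b hac p ih =>
    obtain ⟨x', hx'⟩ := ih (x + fun e => if e = s(a, c) then 1 else 0)
    refine ⟨x', fun u => ?_⟩
    have hstep := sum_filter_adj_add_indicator G x hac u
    rw [hx' u]
    simp only [Pi.add_apply] at hstep ⊢
    rw [hstep]
    have h2 : ∀ S A B C : ZMod 2, S + A + C + C + B = S + A + B := by decide
    exact h2 _ _ _ _

/-- **Every even charge function on a connected graph is realised** (Urquhart 1987, proof of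
Lemma 4.1, p. 213, the "conversely" half): if `G` is connected and `c : Fin v → ZMod 2`
(with at most `n` charged vertices) has `∑ c = 0`, some edge labelling
`x` has `∑_{w ∼ u} x(s(u, w)) = c u` at every `u`. Induction: if `a` is charged, a second
charged `b ≠ a` exists as the charges sum to `0`; transfer the charges of `a`, `b` away,
realise the rest, transfer back along a walk from `a` to `b`. [cite: Urquhart1987, Lemma 4.1] -/
theorem exists_edgeLabel_of_sum_eq_zero (G : SimpleGraph (Fin v)) [DecidableRel G.Adj]
    (hG : G.Connected) :
    ∀ (n : ℕ) (c : Fin v → ZMod 2), (Finset.univ.filter (fun u => c u ≠ 0)).card ≤ n →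
      (∑ u, c u) = 0 → ∃ x : Sym2 (Fin v) → ZMod 2, ∀ u : Fin v,
        (∑ w ∈ Finset.univ.filter (G.Adj u ·), x s(u, w)) = c u := by
  -- no charged vertex: the zero labelling
  have base : ∀ c : Fin v → ZMod 2, (∀ u, c u = 0) → ∃ x : Sym2 (Fin v) → ZMod 2,
      ∀ u : Fin v, (∑ w ∈ Finset.univ.filter (G.Adj u ·), x s(u, w)) = c u :=
    fun c h0 => ⟨fun _ => 0, fun u => by rw [Finset.sum_const_zero, h0 u]⟩
  intro n
  induction n with
  | zero =>
    intro c hc _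
    have hempty := Finset.filter_eq_empty_iff.1 (Finset.card_eq_zero.1 (Nat.le_zero.1 hc))
    exact base c fun u => by_contra fun hu => hempty (Finset.mem_univ u) hu
  | succ n ih =>
    intro c hc hsum
    by_cases h0 : ∀ u, c u = 0
    · exact base c h0
    push Not at h0
    obtain ⟨a, ha⟩ := h0
    -- a second charged vertex exists since the charges sum to `0`
    obtain ⟨b, hba, hb⟩ : ∃ b, b ≠ a ∧ c b ≠ 0 := by
      by_contra hnone
      push Not at hnone
      have hsingle : ∑ u, c u = c a :=
        Finset.sum_eq_single a (fun b _ hb => hnone b hb) fun h => absurd (Finset.mem_univ a) h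
      exact ha (hsingle ▸ hsum)
    have h1 : ∀ z : ZMod 2, z ≠ 0 → z = 1 := by decide
    -- transfer the charges of `a` and `b` away
    set c' : Fin v → ZMod 2 :=
      fun u => c u + (if u = a then 1 else 0) + (if u = b then 1 else 0) with hc'
    have hc'a : c' a = 0 := by simp only [hc', if_true, if_neg hba.symm, h1 _ ha]; decide
    have hc'b : c' b = 0 := by simp only [hc', if_true, if_neg hba, h1 _ hb]; decide
    have hsub : Finset.univ.filter (fun u => c' u ≠ 0) ⊆
        Finset.univ.filter (fun u => c u ≠ 0) := by
      intro u hu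
      simp only [Finset.mem_filter, Finset.mem_univ, true_and] at hu ⊢
      have hua : u ≠ a := fun h => hu (h ▸ hc'a)
      have hub : u ≠ b := fun h => hu (h ▸ hc'b)
      simpa only [hc', if_neg hua, if_neg hub, add_zero] using hu
    have hcard : (Finset.univ.filter (fun u => c' u ≠ 0)).card ≤ n := by
      have := Finset.card_lt_card
        ((Finset.ssubset_iff_of_subset hsub).2 ⟨a, by simp [ha], by simp [hc'a]⟩)
      omega
    have hδ : ∀ d : Fin v, (∑ u, if u = d then (1 : ZMod 2) else 0) = 1 := fun d => by
      rw [Finset.sum_ite_eq']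
      simp
    have hsum' : ∑ u, c' u = 0 := by
      simp only [hc', Finset.sum_add_distrib, hδ, hsum]
      decide
    obtain ⟨x', hx'⟩ := ih c' hcard hsum'
    -- transfer back along a walk from `a` to `b`
    obtain ⟨p⟩ := hG.preconnected a b
    obtain ⟨x, hx⟩ := exists_edgeLabel_walk G p x'
    refine ⟨x, fun u => ?_⟩
    rw [hx u, hx' u]
    have h2 : ∀ z A B : ZMod 2, z + A + B + A + B = z := by decide
    exact h2 _ _ _

/-! ### Assembly -/

/-- Parities in `ℕ` versus values in `ZMod 2`: `n % 2 = b.toNat` iff `(n : ZMod 2)` is the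
indicator of `b`. [folklore] -/
theorem mod_two_eq_toNat_iff (n : ℕ) (b : Bool) :
    n % 2 = b.toNat ↔ ((n : ZMod 2) = if b then 1 else 0) := by
  rw [← ZMod.val_natCast]
  generalize (n : ZMod 2) = z
  cases b <;> (revert z; decide)

/-- **Odd charge is contradictory** (Urquhart 1987, proof of Lemma 4.1, p. 213, first half;
no connectivity needed): if `σ` satisfies `τ(G, χ)` then `#{u | χ u}` is even — the vertex
parities are the `χ u` and they sum to `0`. (Per assignment; the named fact
`tseitinCNF_not_satisfiable` is its contrapositive.) [cite: Urquhart1987, Lemma 4.1] -/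
theorem even_card_of_eval_tseitinCNF (G : SimpleGraph (Fin v)) [DecidableRel G.Adj]
    (χ : Fin v → Bool) {σ : ℕ → Bool} (hσ : (tseitinCNF G χ).eval σ = true) :
    Even (Finset.univ.filter fun u => χ u = true).card := by
  have hT := (eval_tseitinCNF_eq_true_iff G χ σ).1 hσ
  have h0 := sum_card_filter_adj_eq_zero G σ
  have hχ : ∀ u : Fin v, ((Finset.univ.filter
      (fun w => G.Adj u w ∧ σ (tseitinEdgeVar s(u, w)) = true)).card : ZMod 2) =
      if χ u then 1 else 0 := fun u => (mod_two_eq_toNat_iff _ _).1 (hT u)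
  simp only [hχ] at h0
  rw [Finset.sum_boole] at h0
  exact ZMod.natCast_eq_zero_iff_even.1 h0

/-- **Discharge of `tseitinCNF_satisfiable_iff`** = Urquhart 1987, Lemma 4.1 ("If `G` is a
connected graph, then the set of clauses `S(G')` is contradictory if and only if
`Charge(G') = 1`", p. 213), for the labelling of `G` by positive literals and in the
contrapositive form: for connected `G`, `τ(G, χ)` is satisfiable iff `#{u | χ u}` is even.
(⟹) `even_card_of_eval_tseitinCNF` (every edge is counted at both ends). (⟸) realise the
even charge `χ` by an edge labelling (`exists_edgeLabel_of_sum_eq_zero`, Urquhart's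
"conversely" argument) and read it as an assignment of the edge variables through the
injective numbering `tseitinEdgeVar`, checked by `eval_tseitinCNF_eq_true_iff`.
[cite: Urquhart1987, Lemma 4.1] -/
theorem tseitinCNF_satisfiable_iff_holds : tseitinCNF_satisfiable_iff (v := v) := by
  intro G _ χ hc
  refine ⟨fun ⟨σ, hσ⟩ => even_card_of_eval_tseitinCNF G χ hσ, fun heven => ?_⟩
  have hsum : (∑ u : Fin v, if χ u then (1 : ZMod 2) else 0) = 0 := by
    rw [Finset.sum_boole]
    exact ZMod.natCast_eq_zero_iff_even.2 heven
  obtain ⟨x, hx⟩ := exists_edgeLabel_of_sum_eq_zero G hc _ (fun u => if χ u then 1 else 0)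
    le_rfl hsum
  -- the assignment of the edge variables induced by the labelling `x`
  have hiff : ∀ u w : Fin v,
      decide (∃ e, tseitinEdgeVar e = tseitinEdgeVar s(u, w) ∧ x e = 1) = true ↔
        x s(u, w) = 1 := by
    intro u w
    rw [decide_eq_true_iff]
    constructor
    · rintro ⟨e, he, hxe⟩
      rwa [tseitinEdgeVar_injective he] at hxe
    · exact fun h => ⟨_, rfl, h⟩
  have h10 : ∀ z : ZMod 2, z ≠ 1 → z = 0 := by decide
  refine ⟨fun n => decide (∃ e, tseitinEdgeVar e = n ∧ x e = 1),
    (eval_tseitinCNF_eq_true_iff G χ _).2 fun u => ?_⟩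
  rw [mod_two_eq_toNat_iff, ← hx u, Finset.natCast_card_filter, Finset.sum_filter]
  refine Finset.sum_congr rfl fun w _ => ?_
  by_cases hadj : G.Adj u w
  · rw [if_pos hadj]
    by_cases hx1 : x s(u, w) = 1
    · rw [hx1, if_pos ⟨hadj, (hiff u w).2 hx1⟩]
    · rw [if_neg fun h => hx1 ((hiff u w).1 h.2), h10 _ hx1]
  · rw [if_neg fun h => hadj h.1, if_neg hadj]

end Literature.Computability.MetaComplexity
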